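import Summits.Ventures.LatticeQCDFlow.Scaling.ClockConditionedContraction
import Summits.Ventures.LatticeQCDFlow.Scaling.ClockConditionedRenewal

/-!
HONEST FRAMING: exact (Metropolis-corrected) sampling algorithms for lattice gauge theory; figures
of merit are autocorrelation/cost numbers at stated couplings and volumes; no continuum-physics
claim.

# ClockConditionedMixingTime — CYCLE → STEP BY CONDITIONING ON THE CLOCK, ASSEMBLED: PER-ATTEMPT-COUNT CONTRACTION RATES `r_j ∈ [0,1]` AVERAGING TO `r̃` GIVE
# `d_S(n) ≤ D·((1−r̃)ᵏ + (2ᵏ⁺¹−1)((1+σ)/2)ⁿ)` FOR EVERY `k`, HENCE `t_mix^S(ε) ≤ ⌈(2/(1−σ))·(log(1/ε) + log D + (k+2)log 2)⌉` WITH `k = ⌈(log(1/ε) + log(2D))/r̃⌉` — ORDER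
# `(log(D/ε))/((1−σ)r̃)`, THE SHARP STEP LOGARITHM; SIGNED RATES GIVE `d_S(n) ≤ (2D/r̃)(1 + (1−σ)r̃/(8(1+q)))⁻ⁿ` (lean-2 GEN-39, ours)

Venture-side (OURS).  Cell `lqcd-flow` (pub-lqcd), unit `pub-lqcd-lean-2-g39`, 2026-08-30.  Chapter Y, file C3 = C1 (`clock_worstTvDist_le`: `d_S(n) ≤ D·u_n`) + C2 (the bounds on the renewal
sequence `u`).  Setting of C1: `A, B ≥ 0` with unit row sums on a finite space, `0 ≤ σ < 1`, `S = σA + (1−σ)B`, the powers `Sⁿ, Aⁿ` and the cycle kernels `C_j = AʲB` by their recursions, a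
cost `ρ` with `ρ(x,x) = 0`, `1 ≤ ρ(x,y) ≤ D` off the diagonal, per-attempt-count transport contraction `ρ_K(C_j(x,·),C_j(y,·)) ≤ (1−r_j)ρ(x,y)`, a stationary probability vector `π`.

* **`clock_worstTvDist_le_explicit`** (rates in `[0,1]`, `Σ_{j<n}σʲ(1−σ)(1−r_j) ≤ 1−r̃`): `d_S(n) ≤ D·((1−r̃)ᵏ + (2ᵏ⁺¹−1)((1+σ)/2)ⁿ)` for every `k, n`;
* **`clock_mixingTime_le`**: for `0 < ε`, every natural `k ≥ (−log ε + log(2D))/r̃` gives `t_mix^S(ε) ≤ ⌈(2/(1−σ))·(−log ε + log D + (k+2)·log 2)⌉₊`;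
* **`clock_worstTvDist_le_signed`** (rates `−q ≤ r_j ≤ 1`): `d_S(n) ≤ (2D/r̃)·(1 + (1−σ)r̃/(8(1+q)))⁻ⁿ`.

Reading (no numerics implied): this is OPEN-MATH item 1 (i) (b′) CONDITIONAL on per-attempt-count contraction of the lumped star's `j`-attempt cycle kernels (the shape of Conjecture W′ of
MEMO-gen36; the mixture contraction of chapter W is the `σʲ(1−σ)`-average of these and does not imply them); with `r̃ ≍ σp̄/K` and `D ≍ K²` the first bound is
`O((K/(σ(1−σ)p̄))·log(K/ε))` steps.  Literature grade (cell rule): OWN, elementary; nothing cited; no new bib keys.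
-/

open Finset
open Literature.Probability.MarkovChains

namespace Summit.Ventures.LatticeQCDFlow.Scaling

section ClockMixing
variable {X : Type*} [Fintype X] [DecidableEq X]
variable {A B S : X → X → ℝ} {σ : ℝ} {Sn An C : ℕ → X → X → ℝ} {ρ : X → X → ℝ} {r u : ℕ → ℝ} {D rt : ℝ} {π : X → ℝ}

/-- **`d_S(n) ≤ D·((1−r̃)ᵏ + (2ᵏ⁺¹−1)((1+σ)/2)ⁿ)`** for every `k` (non-negative per-attempt-count rates averaging to `r̃ ≤ 1`). [ours] -/
theorem clock_worstTvDist_le_explicit (hA0 : ∀ x y, 0 ≤ A x y) (hA1 : ∀ x, ∑ y, A x y = 1) (hB0 : ∀ x y, 0 ≤ B x y) (hB1 : ∀ x, ∑ y, B x y = 1)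
    (hσ0 : 0 ≤ σ) (hσ1 : σ < 1) (hS : ∀ x y, S x y = σ * A x y + (1 - σ) * B x y)
    (hSn0 : ∀ x y, Sn 0 x y = if x = y then 1 else 0) (hSns : ∀ n x y, Sn (n + 1) x y = ∑ z, S x z * Sn n z y)
    (hAn0 : ∀ x y, An 0 x y = if x = y then 1 else 0) (hAns : ∀ n x y, An (n + 1) x y = ∑ z, A x z * An n z y)
    (hC0 : ∀ x y, C 0 x y = B x y) (hCs : ∀ j x y, C (j + 1) x y = ∑ z, A x z * C j z y)
    (hρd : ∀ x, ρ x x = 0) (hρ1 : ∀ x y, x ≠ y → 1 ≤ ρ x y) (hρD : ∀ x y, ρ x y ≤ D)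
    (hr0 : ∀ j, 0 ≤ r j) (hr1 : ∀ j, r j ≤ 1) (hrt1 : rt ≤ 1) (hmean : ∀ n, ∑ j ∈ range n, σ ^ j * (1 - σ) * (1 - r j) ≤ 1 - rt)
    (hcontr : ∀ j x y, transportDist ρ (C j x) (C j y) ≤ (1 - r j) * ρ x y)
    (hu : ∀ n, u n = (∑ j ∈ range n, σ ^ j * (1 - σ) * (1 - r j) * u (n - 1 - j)) + σ ^ n)
    (hπ0 : ∀ x, 0 ≤ π x) (hπ1 : ∑ x, π x = 1) (hπS : IsStationary π S) (k n : ℕ) :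
    worstTvDist S π n ≤ D * ((1 - rt) ^ k + (2 ^ (k + 1) - 1) * ((1 + σ) / 2) ^ n) := by
  classical
  -- the "fewer than `k` redraws" sequence, by recursion on `k`
  let Bk : ℕ → ℕ → ℝ := fun k => Nat.rec (fun _ => (0 : ℝ)) (fun _ Bp => fun n => (∑ j ∈ range n, σ ^ j * (1 - σ) * Bp (n - 1 - j)) + σ ^ n) k
  have hBk0 : ∀ n, Bk 0 n = 0 := fun _ => rfl
  have hBks : ∀ k n, Bk (k + 1) n = (∑ j ∈ range n, σ ^ j * (1 - σ) * Bk k (n - 1 - j)) + σ ^ n := fun _ _ => rfl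
  have hD : 0 ≤ D := by
    -- `X` is nonempty (`π` has mass one), so `0 = ρ(x,x) ≤ D`
    rcases isEmpty_or_nonempty X with h | ⟨⟨x⟩⟩
    · have : (∑ x, π x) = 0 := by simp [Finset.univ_eq_empty]
      linarith
    · have := hρD x x; rw [hρd] at this; exact this
  calc worstTvDist S π n ≤ D * u n :=
        clock_worstTvDist_le hA0 hA1 hB0 hB1 hσ0 hσ1 hS hSn0 hSns hAn0 hAns hC0 hCs hρd hρ1 hρD hr1 hcontr hu hπ0 hπ1 hπS n
    _ ≤ D * ((1 - rt) ^ k + (2 ^ (k + 1) - 1) * ((1 + σ) / 2) ^ n) :=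
        mul_le_mul_of_nonneg_left (renewal_le_explicit hσ0 hσ1 hr0 hr1 hrt1 hmean hu hBk0 hBks k n) hD

/-- The two exponential estimates behind the mixing time: `(1−r̃)ᵏ·(2D) ≤ ε` once `k ≥ (−log ε + log(2D))/r̃`, and `(2ᵏ⁺¹−1)((1+σ)/2)ᴺ·D ≤ ε/2` once
`N ≥ (2/(1−σ))(−log ε + log D + (k+2)log 2)`. [ours] -/
theorem clock_mixing_arith (hσ0 : 0 ≤ σ) (hσ1 : σ < 1) (hrt0 : 0 < rt) (hrt1 : rt ≤ 1) (hD : 0 < D) {ε : ℝ} (hε : 0 < ε) {k N : ℕ}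
    (hk : (-Real.log ε + Real.log (2 * D)) / rt ≤ k) (hN : 2 / (1 - σ) * (-Real.log ε + Real.log D + (k + 2) * Real.log 2) ≤ N) :
    D * ((1 - rt) ^ k + (2 ^ (k + 1) - 1) * ((1 + σ) / 2) ^ N) ≤ ε := by
  -- first term
  have h1 : (1 - rt) ^ k * (2 * D) ≤ ε := by
    have hle : (1 - rt) ^ k ≤ Real.exp (-rt) ^ k := pow_le_pow_left₀ (by linarith) (by linarith [Real.add_one_le_exp (-rt)]) k
    exact (mul_le_mul_of_nonneg_right hle (by linarith)).trans (exp_neg_pow_mul_le hrt0 hε hk)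
  -- second term: `λ = 1 − (1−σ)/2 ≤ e^{−(1−σ)/2}` and `log(2^{k+2}D) = log D + (k+2) log 2`
  have hα : 0 < (1 - σ) / 2 := by linarith
  have h2 : ((1 + σ) / 2) ^ N * (2 ^ (k + 2) * D) ≤ ε := by
    have hle : ((1 + σ) / 2) ^ N ≤ Real.exp (-((1 - σ) / 2)) ^ N :=
      pow_le_pow_left₀ (by linarith) (by linarith [Real.add_one_le_exp (-((1 - σ) / 2))]) N
    refine (mul_le_mul_of_nonneg_right hle (by positivity)).trans (exp_neg_pow_mul_le hα hε ?_)
    rw [Real.log_mul (by positivity) hD.ne', Real.log_pow]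
    rw [div_le_iff₀ hα]
    rw [div_mul_eq_mul_div, div_le_iff₀ (by linarith : (0:ℝ) < 1 - σ)] at hN
    push_cast at hN ⊢
    nlinarith
  have h2' : D * ((2 ^ (k + 1) - 1) * ((1 + σ) / 2) ^ N) ≤ ε / 2 := by
    have hl : 0 ≤ ((1 + σ) / 2) ^ N := pow_nonneg (by linarith) N
    have : D * ((2 ^ (k + 1) - 1) * ((1 + σ) / 2) ^ N) ≤ D * (2 ^ (k + 1) * ((1 + σ) / 2) ^ N) :=
      mul_le_mul_of_nonneg_left (mul_le_mul_of_nonneg_right (by linarith) hl) hD.le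
    have e : D * (2 ^ (k + 1) * ((1 + σ) / 2) ^ N) = (((1 + σ) / 2) ^ N * (2 ^ (k + 2) * D)) / 2 := by rw [pow_succ (2:ℝ) (k + 1)]; ring
    linarith
  have h1' : D * (1 - rt) ^ k ≤ ε / 2 := by nlinarith
  nlinarith

/-- **THE SHARP STEP LOGARITHM (conditional on per-attempt-count contraction).**  Under the hypotheses of `clock_worstTvDist_le_explicit` with `0 < r̃ ≤ 1` and `0 < ε`: for every natural
`k ≥ (−log ε + log(2D))/r̃`, `t_mix^S(ε) ≤ ⌈(2/(1−σ))·(−log ε + log D + (k+2)·log 2)⌉₊` — order `(1/((1−σ)r̃))·log(D/ε)`. [ours] -/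
theorem clock_mixingTime_le (hA0 : ∀ x y, 0 ≤ A x y) (hA1 : ∀ x, ∑ y, A x y = 1) (hB0 : ∀ x y, 0 ≤ B x y) (hB1 : ∀ x, ∑ y, B x y = 1)
    (hσ0 : 0 ≤ σ) (hσ1 : σ < 1) (hS : ∀ x y, S x y = σ * A x y + (1 - σ) * B x y)
    (hSn0 : ∀ x y, Sn 0 x y = if x = y then 1 else 0) (hSns : ∀ n x y, Sn (n + 1) x y = ∑ z, S x z * Sn n z y)
    (hAn0 : ∀ x y, An 0 x y = if x = y then 1 else 0) (hAns : ∀ n x y, An (n + 1) x y = ∑ z, A x z * An n z y)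
    (hC0 : ∀ x y, C 0 x y = B x y) (hCs : ∀ j x y, C (j + 1) x y = ∑ z, A x z * C j z y)
    (hρd : ∀ x, ρ x x = 0) (hρ1 : ∀ x y, x ≠ y → 1 ≤ ρ x y) (hρD : ∀ x y, ρ x y ≤ D) (hDpos : 0 < D)
    (hr0 : ∀ j, 0 ≤ r j) (hr1 : ∀ j, r j ≤ 1) (hrt0 : 0 < rt) (hrt1 : rt ≤ 1) (hmean : ∀ n, ∑ j ∈ range n, σ ^ j * (1 - σ) * (1 - r j) ≤ 1 - rt)
    (hcontr : ∀ j x y, transportDist ρ (C j x) (C j y) ≤ (1 - r j) * ρ x y)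
    (hu : ∀ n, u n = (∑ j ∈ range n, σ ^ j * (1 - σ) * (1 - r j) * u (n - 1 - j)) + σ ^ n)
    (hπ0 : ∀ x, 0 ≤ π x) (hπ1 : ∑ x, π x = 1) (hπS : IsStationary π S) {ε : ℝ} (hε : 0 < ε) {k : ℕ}
    (hk : (-Real.log ε + Real.log (2 * D)) / rt ≤ k) :
    mixingTime S π ε ≤ ⌈2 / (1 - σ) * (-Real.log ε + Real.log D + (k + 2) * Real.log 2)⌉₊ :=
  mixingTime_le S π ((clock_worstTvDist_le_explicit hA0 hA1 hB0 hB1 hσ0 hσ1 hS hSn0 hSns hAn0 hAns hC0 hCs hρd hρ1 hρD hr0 hr1 hrt1 hmean hcontr hu hπ0 hπ1 hπS k _).trans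
    (clock_mixing_arith hσ0 hσ1 hrt0 hrt1 hDpos hε hk (Nat.le_ceil _)))

/-- **Signed rates:** with `−q ≤ r_j ≤ 1` (some cycle lengths may expand) and `Σ_{j<n}σʲ(1−σ)(1−r_j) ≤ 1−r̃`, `0 < r̃ ≤ 1`: `d_S(n) ≤ (2D/r̃)·(1 + (1−σ)r̃/(8(1+q)))⁻ⁿ`. [ours] -/
theorem clock_worstTvDist_le_signed (hA0 : ∀ x y, 0 ≤ A x y) (hA1 : ∀ x, ∑ y, A x y = 1) (hB0 : ∀ x y, 0 ≤ B x y) (hB1 : ∀ x, ∑ y, B x y = 1)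
    (hσ0 : 0 ≤ σ) (hσ1 : σ < 1) (hS : ∀ x y, S x y = σ * A x y + (1 - σ) * B x y)
    (hSn0 : ∀ x y, Sn 0 x y = if x = y then 1 else 0) (hSns : ∀ n x y, Sn (n + 1) x y = ∑ z, S x z * Sn n z y)
    (hAn0 : ∀ x y, An 0 x y = if x = y then 1 else 0) (hAns : ∀ n x y, An (n + 1) x y = ∑ z, A x z * An n z y)
    (hC0 : ∀ x y, C 0 x y = B x y) (hCs : ∀ j x y, C (j + 1) x y = ∑ z, A x z * C j z y)
    (hρd : ∀ x, ρ x x = 0) (hρ1 : ∀ x y, x ≠ y → 1 ≤ ρ x y) (hρD : ∀ x y, ρ x y ≤ D) (hDpos : 0 < D)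
    {q : ℝ} (hq : 0 ≤ q) (hrq : ∀ j, -q ≤ r j) (hr1 : ∀ j, r j ≤ 1) (hrt0 : 0 < rt) (hrt1 : rt ≤ 1)
    (hmean : ∀ n, ∑ j ∈ range n, σ ^ j * (1 - σ) * (1 - r j) ≤ 1 - rt)
    (hcontr : ∀ j x y, transportDist ρ (C j x) (C j y) ≤ (1 - r j) * ρ x y)
    (hu : ∀ n, u n = (∑ j ∈ range n, σ ^ j * (1 - σ) * (1 - r j) * u (n - 1 - j)) + σ ^ n)
    (hπ0 : ∀ x, 0 ≤ π x) (hπ1 : ∑ x, π x = 1) (hπS : IsStationary π S) (n : ℕ) :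
    worstTvDist S π n ≤ 2 * D / rt * ((1 + (1 - σ) * rt / (8 * (1 + q)))⁻¹) ^ n := by
  calc worstTvDist S π n ≤ D * u n :=
        clock_worstTvDist_le hA0 hA1 hB0 hB1 hσ0 hσ1 hS hSn0 hSns hAn0 hAns hC0 hCs hρd hρ1 hρD hr1 hcontr hu hπ0 hπ1 hπS n
    _ ≤ D * ((2 / rt) * ((1 + (1 - σ) * rt / (8 * (1 + q)))⁻¹) ^ n) :=
        mul_le_mul_of_nonneg_left (renewal_le_signed hσ0 hσ1 hrt0 hrt1 hq hrq hr1 hmean hu rfl n) hDpos.le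
    _ = 2 * D / rt * ((1 + (1 - σ) * rt / (8 * (1 + q)))⁻¹) ^ n := by ring

end ClockMixing

end Summit.Ventures.LatticeQCDFlow.Scaling
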